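import Literature.NumberTheory.EllipticCurves.PAdicLFunctionTameUnitLevelChangeProofs
import Literature.NumberTheory.EllipticCurves.PAdicLFunctionTameConvergenceProofs
import Literature.NumberTheory.EllipticCurves.PAdicMeasureTransformTranslationProofs
import Literature.NumberTheory.EllipticCurves.PAdicLFunctionInvolutionProofs
import HarnessLib

/-!
# Matsuno 2000, Lemma 3.3 IN THE KERNEL: raising the tame level of the depleted `p`-adic `L`-function multiplies it by the
# Euler-type factor, `L_p(f, α, 𝟙_{mℓ}, T) = (a_ℓ − (1+T)^{c_ℓ} − (1+T)^{−c_ℓ}) · L_p(f, α, 𝟙_m, T)` (PROOFS ONLY)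

Cell bsd-2adic, seat conv-1 (planner RULING RC-159 road P2e). Here `𝟙_m` is the trivial Dirichlet character mod `m`
(`(1 : DirichletCharacter ℚ_[p] m)`), `ℓ ∤ pmN` a prime, `a_ℓ = a_ℓ(f)`, and `c_ℓ ∈ ℤ_p` the exponent of `⟨ℓ⟩ = γ^{c_ℓ}`
(`ℓ ≡ η_ℓ γ^{c_ℓ mod pⁿ} (mod p^{n+e₀})`, `exists_teichmuller_exponent_natCast`); `(1+T)^{c} = PowerSeries.binomialSeries ℚ_[p] c`.
This is K. Matsuno, J. Number Theory 84 (2000), Lemma 3.3 (pp. 87–88: `G_{p,mℓ}(E, φ, T) = h_ℓ(E, φ, T) G_{p,m}(E, φ, T)`,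
`h_ℓ = a_ℓ − φ⁻¹(ℓ)(1+T)^{−t(ℓ)} − ε(ℓ)φ(ℓ)(1+T)^{t(ℓ)}`) for the trivial tame character `φ = 𝟙_m` and a good prime `ℓ`
(`ε(ℓ) = 1`), in the tree's normalisation. Proof: at every level the `𝟙_{mℓ}`-weighted measure is
`a_ℓ W_m − W_m(ℓ ·) − W_m(ℓ⁻¹ ·)` (`weighted_msdMeasureTame_levelChange`, Lemma 2.2); the Riemann sums of the two translates
converge to the coefficients of `(1+T)^{−c_ℓ} L` and `(1+T)^{c_ℓ} L` (`tendsto_riemannSum_translate`, the abstract translation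
lemma over `PAdicMeasureTransform`; `ℓ⁻¹ ≡ η_ℓ⁻¹ γ^{−c_ℓ}` by `classMap_mul`/`classMap_one`), and the Riemann sums of
`L_p(f, α, 𝟙_m)` converge (`tendsto_padicLRiemannSumTame_holds`).

References: K. Matsuno, J. Number Theory 84 (2000), Lemma 2.2 (p. 85), Lemma 3.3 (pp. 87–88) [Matsuno2000]; B. Mazur, J. Tate,
J. Teitelbaum, Invent. Math. 84 (1986), §I.10–I.13 [MazurTateTeitelbaum1986Invent]; B. Mazur, P. Swinnerton-Dyer, Invent. Math.
25 (1974), §8 Lemma 2 [MazurSwinnertonDyer1974Invent].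
-/

noncomputable section

open scoped MatrixGroups ModularForm

open CongruenceSubgroup Filter Topology PowerSeries Literature.NumberTheory.EllipticCurves.ModularForms

namespace Literature.NumberTheory.EllipticCurves

section Main

variable {N : ℕ} [NeZero N] {f : CuspForm (Gamma0 N) 2} {p : ℕ} [Fact p.Prime] {m ℓ : ℕ} [NeZero m] [NeZero (m * ℓ)]

/-- The Teichmüller–exponent datum of `ℓ⁻¹` from that of `ℓ`: if `ℓ ≡ η γ^{c mod pⁿ}` then `ℓ⁻¹ ≡ η⁻¹ γ^{(−c) mod pⁿ}`
(`classMap_mul`, `classMap_one`). [cite: MazurTateTeitelbaum1986Invent, §I.13 (pp. 18–19)] -/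
theorem classMap_inv_eq_inv_natCast {teich : rootsOfUnity (torsionOrder p) ℤ_[p]} {c : ℤ_[p]} (hℓp : ℓ.Coprime p)
    (hc : ∀ n : ℕ, PadicInt.toZModPow (n + cyclotomicExponent p) ((teich : ℤ_[p]ˣ) : ℤ_[p]) *
        (cyclotomicGenerator p : ZMod (p ^ (n + cyclotomicExponent p))) ^ (PadicInt.toZModPow n c).val =
          (ℓ : ZMod (p ^ (n + cyclotomicExponent p)))) (n : ℕ) :
    PadicInt.toZModPow (n + cyclotomicExponent p) (((teich⁻¹ : rootsOfUnity (torsionOrder p) ℤ_[p]) : ℤ_[p]ˣ) : ℤ_[p]) *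
        (cyclotomicGenerator p : ZMod (p ^ (n + cyclotomicExponent p))) ^ (PadicInt.toZModPow n (-c)).val =
      (ℓ : ZMod (p ^ (n + cyclotomicExponent p)))⁻¹ := by
  haveI : NeZero (p ^ (n + cyclotomicExponent p)) := ⟨pow_ne_zero _ (Fact.out : p.Prime).ne_zero⟩
  have hu : IsUnit (ℓ : ZMod (p ^ (n + cyclotomicExponent p))) := by
    rw [ZMod.isUnit_iff_coprime]; exact hℓp.pow_right _
  have hmul := classMap_mul p n teich⁻¹ teich (PadicInt.toZModPow n (-c)) (PadicInt.toZModPow n c)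
  rw [inv_mul_cancel, ← map_add, neg_add_cancel, map_zero, classMap_one p n, hc n] at hmul
  -- `1 = X * ℓ` with `ℓ` a unit ⇒ `X = ℓ⁻¹`
  calc _ = (PadicInt.toZModPow (n + cyclotomicExponent p) (((teich⁻¹ : rootsOfUnity (torsionOrder p) ℤ_[p]) : ℤ_[p]ˣ) : ℤ_[p]) *
        (cyclotomicGenerator p : ZMod (p ^ (n + cyclotomicExponent p))) ^ (PadicInt.toZModPow n (-c)).val) *
        ((ℓ : ZMod (p ^ (n + cyclotomicExponent p))) * (ℓ : ZMod (p ^ (n + cyclotomicExponent p)))⁻¹) := by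
          rw [ZMod.mul_inv_of_unit _ hu, mul_one]
    _ = _ := by rw [← mul_assoc, ← hmul, one_mul]

/-- **Level-`n` form of Matsuno's Lemma 3.3** (from Lemma 2.2 in unit-class form, `weighted_msdMeasureTame_levelChange`):
the Riemann sum of `L_p(f, α, 𝟙_{mℓ})` is `a_ℓ ·` that of `L_p(f, α, 𝟙_m)` minus the Riemann sums of the `𝟙_m`-weighted measure
translated by `ℓ` and by `ℓ⁻¹` (classes `η_ℓ γ^{±c}`). [cite: Matsuno2000, Lemma 2.2 (p. 85) and Lemma 3.3 (pp. 87–88)] -/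
theorem padicLRiemannSumTame_mul_prime_eq (hf : IsNewform0 f)
    (hrat : ∀ r : ℚ, (ratPlusSymbol f r : ℝ) = normalizedPlusSymbol f r)
    (hℓ : ℓ.Prime) (hℓN : ¬ ℓ ∣ N) {aℓ : ℤ} (haℓ : cuspCoeff f ℓ = aℓ) (hmp : m.Coprime p) (hℓp : ℓ.Coprime p)
    (hℓm : ℓ.Coprime m) (α : ℚ_[p])
    {teich : rootsOfUnity (torsionOrder p) ℤ_[p]} {c : ℤ_[p]}
    (hc : ∀ n : ℕ, PadicInt.toZModPow (n + cyclotomicExponent p) ((teich : ℤ_[p]ˣ) : ℤ_[p]) *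
        (cyclotomicGenerator p : ZMod (p ^ (n + cyclotomicExponent p))) ^ (PadicInt.toZModPow n c).val =
          (ℓ : ZMod (p ^ (n + cyclotomicExponent p)))) (k n : ℕ) :
    padicLRiemannSumTame f (m * ℓ) α 1 k n =
      (aℓ : ℚ_[p]) * padicLRiemannSumTame f m α 1 k n -
      (∑ᶠ z : rootsOfUnity (torsionOrder p) ℤ_[p], ∑ s : ZMod (p ^ n),
        (∑ b : ZMod m, (1 : DirichletCharacter ℚ_[p] m) b * msdMeasureTame f m α (n + cyclotomicExponent p)
            ((PadicInt.toZModPow (n + cyclotomicExponent p) ((teich : ℤ_[p]ˣ) : ℤ_[p]) *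
              (cyclotomicGenerator p : ZMod (p ^ (n + cyclotomicExponent p))) ^ (PadicInt.toZModPow n c).val) *
            (PadicInt.toZModPow (n + cyclotomicExponent p) ((z : ℤ_[p]ˣ) : ℤ_[p]) *
              (cyclotomicGenerator p : ZMod (p ^ (n + cyclotomicExponent p))) ^ s.val)) b) *
          ((s.val.choose k : ℕ) : ℚ_[p])) -
      (∑ᶠ z : rootsOfUnity (torsionOrder p) ℤ_[p], ∑ s : ZMod (p ^ n),
        (∑ b : ZMod m, (1 : DirichletCharacter ℚ_[p] m) b * msdMeasureTame f m α (n + cyclotomicExponent p)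
            ((PadicInt.toZModPow (n + cyclotomicExponent p) (((teich⁻¹ : rootsOfUnity (torsionOrder p) ℤ_[p]) : ℤ_[p]ˣ) : ℤ_[p]) *
              (cyclotomicGenerator p : ZMod (p ^ (n + cyclotomicExponent p))) ^ (PadicInt.toZModPow n (-c)).val) *
            (PadicInt.toZModPow (n + cyclotomicExponent p) ((z : ℤ_[p]ˣ) : ℤ_[p]) *
              (cyclotomicGenerator p : ZMod (p ^ (n + cyclotomicExponent p))) ^ s.val)) b) *
          ((s.val.choose k : ℕ) : ℚ_[p])) := by
  classical
  haveI := neZero_torsionOrder p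
  haveI := Fintype.ofFinite (rootsOfUnity (torsionOrder p) ℤ_[p])
  rw [padicLRiemannSumTame_eq_sum_weighted f α 1 k n, padicLRiemannSumTame_eq_sum_weighted f α 1 k n]
  simp only [finsum_eq_sum_of_fintype, Finset.mul_sum, ← Finset.sum_sub_distrib]
  refine Finset.sum_congr rfl fun z _ ↦ Finset.sum_congr rfl fun s _ ↦ ?_
  rw [weighted_msdMeasureTame_levelChange f hf hrat hℓ hℓN haℓ hmp hℓp hℓm α]
  simp only [mul_comm _ ((ℓ : ZMod (p ^ (n + cyclotomicExponent p)))),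
    mul_comm _ ((ℓ : ZMod (p ^ (n + cyclotomicExponent p)))⁻¹)]
  rw [← classMap_inv_eq_inv_natCast hℓp hc n, ← hc n]
  ring

/-- **Matsuno 2000, Lemma 3.3 in the kernel (trivial tame character, good prime `ℓ`), coefficientwise.** For a rational
normalised newform `f` of level `N` prime to `p`, `(m, p) = 1`, `α` the unit root (`α² − a_p α + p = 0`, `‖α‖ = 1`), a prime
`ℓ ∤ N` prime to `p` and to `m` with `a_ℓ(f) = a_ℓ`, and `ℓ ≡ η_ℓ γ^{c mod pⁿ}`:
`[T^k] L_p(f,α,𝟙_{mℓ}) = a_ℓ [T^k] L_p(f,α,𝟙_m) − ∑_{i≤k} (−c choose k−i) [T^i] L_p(f,α,𝟙_m) − ∑_{i≤k} (c choose k−i) [T^i] L_p(f,α,𝟙_m)`,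
i.e. `L_p(f,α,𝟙_{mℓ}) = (a_ℓ − (1+T)^{−c} − (1+T)^{c}) · L_p(f,α,𝟙_m)` (`coeff_C_mul_binomialSeries_mul`).
[cite: Matsuno2000, Lemma 3.3 (pp. 87–88)] [cite: MazurSwinnertonDyer1974Invent, §8 Lemma 2] -/
theorem padicLCoeffTame_mul_prime (hf : IsNewform0 f) (hQ : coeffField f = ⊥) (hpN : ¬ p ∣ N) (hmp : m.Coprime p)
    {ap : ℤ} (hap : cuspCoeff f p = ap) {α : ℚ_[p]} (hα : α ^ 2 - ap * α + p = 0) (hαu : ‖α‖ = 1)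
    (hℓ : ℓ.Prime) (hℓN : ¬ ℓ ∣ N) {aℓ : ℤ} (haℓ : cuspCoeff f ℓ = aℓ) (hℓp : ℓ.Coprime p) (hℓm : ℓ.Coprime m)
    {teich : rootsOfUnity (torsionOrder p) ℤ_[p]} {c : ℤ_[p]}
    (hc : ∀ n : ℕ, PadicInt.toZModPow (n + cyclotomicExponent p) ((teich : ℤ_[p]ˣ) : ℤ_[p]) *
        (cyclotomicGenerator p : ZMod (p ^ (n + cyclotomicExponent p))) ^ (PadicInt.toZModPow n c).val =
          (ℓ : ZMod (p ^ (n + cyclotomicExponent p)))) (k : ℕ) :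
    padicLCoeffTame f (m * ℓ) α 1 k =
      (aℓ : ℚ_[p]) * padicLCoeffTame f m α 1 k -
        ∑ i ∈ Finset.range (k + 1), algebraMap ℤ_[p] ℚ_[p] (Ring.choose (-c) (k - i)) * padicLCoeffTame f m α 1 i -
        ∑ i ∈ Finset.range (k + 1), algebraMap ℤ_[p] ℚ_[p] (Ring.choose c (k - i)) * padicLCoeffTame f m α 1 i := by
  have hα0 : α ≠ 0 := norm_ne_zero_iff.mp (by rw [hαu]; exact one_ne_zero)
  have hrat : ∀ r : ℚ, (ratPlusSymbol f r : ℝ) = normalizedPlusSymbol f r := fun r ↦ ratCast_ratPlusSymbol_holds hf hQ r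
  have hdist := sum_filter_weighted_msdMeasureTame_succ f hf hrat hpN hmp hap hα0 hα (1 : DirichletCharacter ℚ_[p] m)
  obtain ⟨C, hC⟩ := exists_norm_weighted_msdMeasureTame_le f
    (exists_nsmul_modularSymbol_mem_periodLattice_of_isNewform0 hf hQ) hαu (1 : DirichletCharacter ℚ_[p] m)
  have hRS : ∀ k n : ℕ, padicLRiemannSumTame f m α 1 k n = _ := fun k n ↦ padicLRiemannSumTame_eq_sum_weighted f α 1 k n
  have hℓlim := tendsto_riemannSum_translate hdist hC hRS (fun k n ↦ rfl) k
    (RSz := fun k n ↦ ∑ᶠ z : rootsOfUnity (torsionOrder p) ℤ_[p], ∑ s : ZMod (p ^ n),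
        (∑ b : ZMod m, (1 : DirichletCharacter ℚ_[p] m) b * msdMeasureTame f m α (n + cyclotomicExponent p)
            ((PadicInt.toZModPow (n + cyclotomicExponent p) ((teich : ℤ_[p]ˣ) : ℤ_[p]) *
              (cyclotomicGenerator p : ZMod (p ^ (n + cyclotomicExponent p))) ^ (PadicInt.toZModPow n c).val) *
            (PadicInt.toZModPow (n + cyclotomicExponent p) ((z : ℤ_[p]ˣ) : ℤ_[p]) *
              (cyclotomicGenerator p : ZMod (p ^ (n + cyclotomicExponent p))) ^ s.val)) b) *
          ((s.val.choose k : ℕ) : ℚ_[p]))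
  have hℓ'lim := tendsto_riemannSum_translate hdist hC hRS (fun k n ↦ rfl) k
    (RSz := fun k n ↦ ∑ᶠ z : rootsOfUnity (torsionOrder p) ℤ_[p], ∑ s : ZMod (p ^ n),
        (∑ b : ZMod m, (1 : DirichletCharacter ℚ_[p] m) b * msdMeasureTame f m α (n + cyclotomicExponent p)
            ((PadicInt.toZModPow (n + cyclotomicExponent p) (((teich⁻¹ : rootsOfUnity (torsionOrder p) ℤ_[p]) : ℤ_[p]ˣ) : ℤ_[p]) *
              (cyclotomicGenerator p : ZMod (p ^ (n + cyclotomicExponent p))) ^ (PadicInt.toZModPow n (-c)).val) *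
            (PadicInt.toZModPow (n + cyclotomicExponent p) ((z : ℤ_[p]ˣ) : ℤ_[p]) *
              (cyclotomicGenerator p : ZMod (p ^ (n + cyclotomicExponent p))) ^ s.val)) b) *
          ((s.val.choose k : ℕ) : ℚ_[p]))
  rw [neg_neg] at hℓ'lim
  have hmain := tendsto_padicLRiemannSumTame_holds hf hQ hpN hmp hap hα hαu (1 : DirichletCharacter ℚ_[p] m) k
  have hcomb : Tendsto (padicLRiemannSumTame f (m * ℓ) α 1 k) atTop
      (𝓝 ((aℓ : ℚ_[p]) * padicLCoeffTame f m α 1 k -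
        ∑ i ∈ Finset.range (k + 1), algebraMap ℤ_[p] ℚ_[p] (Ring.choose (-c) (k - i)) *
          limUnder atTop (fun n ↦ padicLRiemannSumTame f m α 1 i n) -
        ∑ i ∈ Finset.range (k + 1), algebraMap ℤ_[p] ℚ_[p] (Ring.choose c (k - i)) *
          limUnder atTop (fun n ↦ padicLRiemannSumTame f m α 1 i n))) := by
    refine (((hmain.const_mul _).sub hℓlim).sub hℓ'lim).congr fun n ↦ ?_
    exact (padicLRiemannSumTame_mul_prime_eq hf hrat hℓ hℓN haℓ hmp hℓp hℓm α hc k n).symm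
  rw [padicLCoeffTame, hcomb.limUnder_eq]
  rfl

end Main

end Literature.NumberTheory.EllipticCurves

end
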